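import Literature.Geometry.Kaehler.ComplexTorusLefschetzGroupIdentityComponent
import Literature.Geometry.Kaehler.ComplexTorusLefschetzGroupInvariantsDegreeTwo
import Mathlib.LinearAlgebra.Matrix.SchurComplement
import HarnessLib

/-!
# The quaternionic reflection: a direct factor `M₂(ℂ)` of `End_ℚ(X) ⊗ ℂ` with SYMPLECTIC adjoint involution
# disconnects the centraliser `S(X)(ℂ)` of `End_ℚ(X)` in `Sp(V, E)(ℂ)` — an explicit element of
# `S(X)(ℂ) ∖ Lf(X)(ℂ)` (the engine of «abelian varieties of type (III) are stably degenerate», Murty 1984 /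
# Milne 1999 Remark 4.9, whose type-III instance is the sequel `ComplexTorusAlbertTypeIIIStablyDegenerate`)

Layer `Literature/Geometry/Kaehler`, namespace `Literature.Geometry.Kaehler.ComplexTorus`; lane `lit-hodgefound`
(Track 2 foundations library), Layer A4, SKELETON row **A4-88** (skeleton seat `lit-hodgefound-skel-4`, generation 34),
FILE 1 of 2.  Sequel, BY NAME and without restating anything, of `ComplexTorusLefschetzGroupIdentityComponent`
(`lefschetzGroupC Φ G` = the complex points `S(X)(ℂ)` of the centraliser of `End_ℚ(X)` in `Sp(V, E)`,
`mem_lefschetzGroupC_iff`, `isZariskiClosed_lefschetzGroupC`; `lefschetzIdentityC Φ G = S(X)(ℂ)⁰ = Lf(X)(ℂ)`,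
`lefschetzIdentityC_le`, and Springer 2.2.1 (iii) `lefschetzIdentityC_le_of_relIndex_ne_zero`: every Zariski-closed
subgroup of finite index of `S(X)(ℂ)` contains `Lf(X)(ℂ)`), of `ComplexTorusLefschetzGroupInvariantsDegreeTwo`
(`mul_eq_mul_of_mem_lefschetzGroupC_of_mem_span`: `S(X)(ℂ)` commutes with `End_ℚ(X) ⊗ ℂ`), of
`ComplexTorusHodgeGroupConjugates` (`evalMatC`, `IsZariskiClosed`) and of `ComplexTorusRosati` (`rosati G A = G⁻¹ ᵗA G`,
`rosati_mul`, `mul_rosati`, `rosati_map`).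
THEOREMS ONLY: no definition, no instance, no notation, no named fact (D-0026, net debt 0); helpers are private.

## Sources, verbatim

* J. S. Milne, *Lefschetz classes on abelian varieties*, Duke Math. J. **96** (1999) 639–675 (held
  `paper:doi-10-1215-s0012-7094-99-09620-5`, PDF page = printed page − 638).  §2, p. 650 (p0012 L38–L43): «*Simple
  abelian variety of type III.* This is similar to the preceding case, except that `E = (a, b / F)` with `a ∈ F`
  totally negative (as before) but `b` totally positive, and the ample divisor `D` is chosen so that its Rosati
  involution is the standard involution. […] `S(A)_{k^{al}} ≅ ∏ O(φ_{2,σ₁})` where the product is indexed by the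
  embeddings `σ : F ↪ k^{al}` […] The representation of `O(φ_{2,σ₁})` on `V_{σ₁}`»; p. 652 (p0014 L1–L63),
  «Summary. The following table summarizes the properties of the reductive groups `S(A)`. Type | Group |
  Semisimple | Connected […] III | `O_{g/f}` | Yes | **No** […]»; §4 p. 660–661 (p0022 L64–L78, p0023 L5–L6):
  «**Proposition 4.8** […] (a) `H(Aʳ) = D(Aʳ)` for all `r`; (b) `Hg(A) = L(A)`; (c) `Hg′(A) = S(A)` […]
  **Remark 4.9.** When `A` has an isogeny factor of type III, the conditions in Proposition 4.8 always fail
  because `Hg′(A)` is connected (Deligne 1982, p45) and `S(A)` is not—see the table at the end of Section 2.  In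
  fact, a simple abelian variety `A` of type III supports an exotic Hodge class `c` […] (Murty 1984, 3.2). The
  class `c` is fixed by the identity component of `S(A)` but not by `S(A)` itself.»
* B. B. Gordon, *A survey of the Hodge conjecture for abelian varieties* (App. B of J. D. Lewis, 2nd ed., 1999;
  held `paper:arxiv-alg-geom_9709030`), §7.7 p0021 L43–L49: «for type (III), the intersection of a unitary group
  and a special orthogonal group […] after complexifying, these act […] for type (III), two copies of the standard
  representation of the complex special orthogonal group»; p0021 L28–L30: «by 7.5.2 no abelian variety with a
  factor of type (III) can be stably nondegenerate»; §8.6 p0022 L79–L106 (Theorem [B.82] = Murty 1984).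
* H. Lange, *Abelian Varieties over the Complex Numbers* (2023), §7.2.4 Exercise (4) (the Lefschetz group as the
  connected component of the centraliser of `End_ℚ(X)` in `Sp(W, E)`).

## The mechanism, and what is proved (pure matrix algebra over `ℂ`; CONCRETE torus level `X = E/Φ(ℤ^ι)`)

Milne's `O(φ_{2,σ})`: over `ℂ` a type-III factor of `End_ℚ(X) ⊗ ℝ ≅ ∏ ℍ` becomes `ℍ ⊗_ℝ ℂ ≅ M₂(ℂ)` with the
quaternion conjugation becoming the symplectic (adjugate) involution of `M₂(ℂ)`; on `V_σ ≅ ℂ² ⊗ W` the centraliser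
of `M₂(ℂ)` in `Sp(V_σ)` is the orthogonal group of the symmetric form `E(x, e₁₀ y)` on the corner `W = e₀₀ V_σ`,
and a reflection of `W` (determinant `−1` on `W`) lies outside the identity component.  This file isolates exactly
that computation.  DATA (all hypotheses of the theorems of §5): a rational matrix `G` with `det G ≠ 0`, `ᵗG = −G`
(for the polarised torus: the Gram matrix of the polarisation), and `e : Fin 2 → Fin 2 → M_ι(ℂ)` with
(i) the matrix-unit table `e a b · e c d = δ_{bc} e a d`; (ii) each `e a b` in the `ℂ`-span of `End_ℚ(X)`;
(iii) `ε := e 0 0 + e 1 1` commutes with `End_ℚ(X)` and (iv) `ε · A ∈ span_ℂ {e a b}` for `A ∈ End_ℚ(X)` (the span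
of the `e a b` is a two-sided direct factor `M₂(ℂ)` of `End_ℚ(X) ⊗ ℂ`); (v) the adjoint involution
`A ↦ A† = G_ℂ⁻¹ ᵗA G_ℂ` (`rosati`) satisfies `e₀₀† = e₁₁`, `e₀₁† = −e₀₁`, `e₁₀† = −e₁₀`; (vi) `e 0 0 ≠ 0`.

* §1 matrix-unit bookkeeping: `T = e₀₁ + e₁₀ + (1 − ε)` squares to `1` and conjugates the `e₁₁`-corner embedding
  `N ↦ N e₁₁ + (1 − e₁₁)` to the `e₀₀`-corner embedding (for `N` commuting with the units); the corner embedding is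
  multiplicative.
* §2 THE CORNER DETERMINANT `f(N) = det(N e₀₀ + 1 − e₀₀)` ("`det` of `N` on `W = e₀₀V`"): a polynomial in the
  entries of `N` (`exists_evalMatC_eq_det_corner`), multiplicative on the commutant of `e₀₀`, and — the key —
  **`det_corner_mul_self_of_mem_lefschetzGroupC`: `f(N)² = 1` on `S(X)(ℂ)`** (`det ∘ † = det`,
  `(N e₀₀ + 1 − e₀₀)† = e₁₁ N⁻¹ + 1 − e₁₁`, conjugation by `T`, multiplicativity).
* §3 **`det_corner_eq_one_of_mem_lefschetzIdentityC`: `f ≡ 1` on `Lf(X)(ℂ)`** — `{N ∈ S(X)(ℂ) | f(N) = 1}` is a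
  Zariski-closed subgroup of index `≤ 2` (the kernel of `f : S(X)(ℂ) → {±1}`), so it contains `S(X)(ℂ)⁰`.
* §4 THE QUATERNIONIC REFLECTION: a vector `v ∈ e₀₀ V_ℂ` with `q = ᵗv G_ℂ e₁₀ v ≠ 0` exists (the symmetric form
  `ᵗx G_ℂ e₁₀ y` is non-degenerate on `e₀₀V_ℂ`; `exists_corner_vector_form_ne_zero`), and for
  `ρ = e₀₀ − (2/q)·v ᵗ(ᵗ(G_ℂ e₁₀) v)` ("reflection of `W` in `v`"), `M₀ = ρ + e₁₀ ρ e₀₁ + (1 − ε)`: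
  `ρ² = e₀₀`, `ρ† = e₁₀ ρ e₀₁`, hence `M₀† = M₀`, `M₀² = 1`, `ᵗM₀ G_ℂ M₀ = G_ℂ`, `M₀` commutes with `End_ℚ(X)`,
  `det M₀ = 1`, and `f(M₀) = 1 − 2 = −1`.
* §5 `exists_mem_lefschetzGroupC_det_corner_eq_neg_one_of_matrixUnits` (`∃ M₀ ∈ S(X)(ℂ)`, `M₀² = 1`, `f(M₀) = −1`
  — the form consumed by the exotic-class sequel `ComplexTorusTypeIIIExoticHodgeClass`),
  **`exists_mem_lefschetzGroupC_not_mem_lefschetzIdentityC_of_matrixUnits`** (`∃ M ∈ S(X)(ℂ), M ∉ Lf(X)(ℂ)`),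
  **`lefschetzIdentityC_lt_lefschetzGroupC_of_matrixUnits`** (`Lf(X)(ℂ) = S(X)(ℂ)⁰ ⊊ S(X)(ℂ)`: «connected: No»),
  `lefschetzIdentityC_ne_lefschetzGroupC_of_matrixUnits`.

Faithfulness notes. (i) Milne's `S(A)` is an algebraic group; here, as everywhere in this lane since
`ComplexTorusHodgeGroupConjugates`, through its complex points `S(X)(ℂ) ≤ SL_ι(ℂ)` and its strong identity
component; «not connected» is rendered as `S(X)(ℂ)⁰ ≠ S(X)(ℂ)`.  (ii) Nothing is claimed about REAL points: the
non-identity component `{f = −1}` is defined over `ℝ` but need not have real points (for type III, `S(A)(ℝ)` is a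
product of groups `O*(2m)`).  (iii) The Hodge-theoretic consequences (`Hg(X)(ℂ) ⊊ S(X)(ℂ)`, exceptional Hodge
classes on some power) are drawn in FILE 2 from A4-85 (`ComplexTorusStablyNondegenerateHodgeGroup`).

## References

* [Milne1999LefschetzClasses] J. S. Milne, *Lefschetz classes on abelian varieties*, Duke Math. J. 96 (1999)
  639–675: §2 (simple abelian variety of type III, p. 650–651; Summary table, p. 652), Prop. 4.8, Remark 4.9
  (p. 660–661).
* [Murty1984] V. K. Murty, *Exceptional Hodge classes on certain abelian varieties*, Math. Ann. 268 (1984)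
  197–206, §3 (3.2) (cited through Milne 1999, Remark 4.9, and Gordon 1999, §8.6 [B.82]).
* [Gordon1999HodgeAVSurvey] B. B. Gordon, *A survey of the Hodge conjecture for abelian varieties*, in: J. D. Lewis,
  *A survey of the Hodge conjecture*, CRM Monograph Ser. 10 (1999), App. B: Thm. 7.5, §7.7, §8.6.
* [Lange2023AbelianVarietiesComplex] H. Lange, *Abelian Varieties over the Complex Numbers* (2023), §7.2.4
  Exercise (4); §2.4.1 Lemma 2.4.1 (the adjoint involution `A ↦ G⁻¹ ᵗA G`).
* [Springer1998] T. A. Springer, *Linear Algebraic Groups*, 2nd ed. (1998), Prop. 2.2.1 (iii).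
-/

noncomputable section

open Matrix MvPolynomial

namespace Literature.Geometry.Kaehler

namespace ComplexTorus

variable {ι : Type*} [Fintype ι] [DecidableEq ι]

/-! ## §1 Matrix-unit bookkeeping -/

section Units

omit [DecidableEq ι] in
/-- The two elements of `Fin 2`. [folklore] -/
private theorem fin_two_eq_zero_or_eq_one (a : Fin 2) : a = 0 ∨ a = 1 := by
  by_cases h : a = 0
  · exact Or.inl h
  · exact Or.inr (Fin.eq_one_of_ne_zero a h)

variable {e : Fin 2 → Fin 2 → Matrix ι ι ℂ}

omit [DecidableEq ι] in
/-- `e a b · e b d = e a d`. [folklore] -/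
private theorem unit_mul_same (hmul : ∀ a b c d : Fin 2, e a b * e c d = if b = c then e a d else 0)
    (a b d : Fin 2) : e a b * e b d = e a d := by
  simpa using hmul a b b d

omit [DecidableEq ι] in
/-- `e a b · e c d = 0` for `b ≠ c`. [folklore] -/
private theorem unit_mul_ne (hmul : ∀ a b c d : Fin 2, e a b * e c d = if b = c then e a d else 0)
    {a b c d : Fin 2} (h : b ≠ c) : e a b * e c d = 0 := by
  simpa [h] using hmul a b c d

/-- `ε · e a b = e a b` for the unit `ε = e 0 0 + e 1 1`. [folklore] -/
private theorem eps_mul_unit (hmul : ∀ a b c d : Fin 2, e a b * e c d = if b = c then e a d else 0)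
    (a b : Fin 2) : (e 0 0 + e 1 1) * e a b = e a b := by
  obtain rfl | rfl := fin_two_eq_zero_or_eq_one a
  · rw [add_mul, unit_mul_same hmul, unit_mul_ne hmul (by decide), add_zero]
  · rw [add_mul, unit_mul_ne hmul (by decide), unit_mul_same hmul, zero_add]

/-- `e a b · ε = e a b`. [folklore] -/
private theorem unit_mul_eps (hmul : ∀ a b c d : Fin 2, e a b * e c d = if b = c then e a d else 0)
    (a b : Fin 2) : e a b * (e 0 0 + e 1 1) = e a b := by
  obtain rfl | rfl := fin_two_eq_zero_or_eq_one b
  · rw [mul_add, unit_mul_same hmul, unit_mul_ne hmul (by decide), add_zero]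
  · rw [mul_add, unit_mul_ne hmul (by decide), unit_mul_same hmul, zero_add]

/-- `ε² = ε`. [folklore] -/
private theorem eps_mul_eps (hmul : ∀ a b c d : Fin 2, e a b * e c d = if b = c then e a d else 0) :
    (e 0 0 + e 1 1) * (e 0 0 + e 1 1) = e 0 0 + e 1 1 := by
  rw [mul_add, eps_mul_unit hmul, eps_mul_unit hmul]

/-- `e a b · (1 − ε) = 0`. [folklore] -/
private theorem unit_mul_one_sub_eps (hmul : ∀ a b c d : Fin 2, e a b * e c d = if b = c then e a d else 0)
    (a b : Fin 2) : e a b * (1 - (e 0 0 + e 1 1)) = 0 := by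
  rw [mul_sub, mul_one, unit_mul_eps hmul, sub_self]

/-- `(1 − ε) · e a b = 0`. [folklore] -/
private theorem one_sub_eps_mul_unit (hmul : ∀ a b c d : Fin 2, e a b * e c d = if b = c then e a d else 0)
    (a b : Fin 2) : (1 - (e 0 0 + e 1 1)) * e a b = 0 := by
  rw [sub_mul, one_mul, eps_mul_unit hmul, sub_self]

/-- `(1 − ε)² = 1 − ε`. [folklore] -/
private theorem one_sub_eps_mul_self (hmul : ∀ a b c d : Fin 2, e a b * e c d = if b = c then e a d else 0) :
    (1 - (e 0 0 + e 1 1)) * (1 - (e 0 0 + e 1 1)) = 1 - (e 0 0 + e 1 1) := by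
  rw [sub_mul, one_mul, mul_sub, mul_one, eps_mul_eps hmul, sub_self, sub_zero]

/-- **`T² = 1`** for `T = e₀₁ + e₁₀ + (1 − ε)` (the flip of the two corners). [folklore] -/
private theorem flip_mul_flip (hmul : ∀ a b c d : Fin 2, e a b * e c d = if b = c then e a d else 0) :
    (e 0 1 + e 1 0 + (1 - (e 0 0 + e 1 1))) * (e 0 1 + e 1 0 + (1 - (e 0 0 + e 1 1))) = 1 := by
  have h11 : e 0 1 * e 0 1 = 0 := unit_mul_ne hmul (by decide)
  have h12 : e 0 1 * e 1 0 = e 0 0 := unit_mul_same hmul 0 1 0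
  have h21 : e 1 0 * e 0 1 = e 1 1 := unit_mul_same hmul 1 0 1
  have h22 : e 1 0 * e 1 0 = 0 := unit_mul_ne hmul (by decide)
  have h1c := unit_mul_one_sub_eps hmul 0 1
  have h2c := unit_mul_one_sub_eps hmul 1 0
  have hc1 := one_sub_eps_mul_unit hmul 0 1
  have hc2 := one_sub_eps_mul_unit hmul 1 0
  have hcc := one_sub_eps_mul_self hmul
  simp only [add_mul, mul_add, h11, h12, h21, h22, h1c, h2c, hc1, hc2, hcc]
  abel

/-- `T · e₁₁ = e₀₁`. [folklore] -/
private theorem flip_mul_unit11 (hmul : ∀ a b c d : Fin 2, e a b * e c d = if b = c then e a d else 0) :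
    (e 0 1 + e 1 0 + (1 - (e 0 0 + e 1 1))) * e 1 1 = e 0 1 := by
  rw [add_mul, add_mul, unit_mul_same hmul, unit_mul_ne hmul (by decide), one_sub_eps_mul_unit hmul, add_zero,
    add_zero]

/-- `T · e₁₀ = e₀₀`. [folklore] -/
private theorem flip_mul_unit10 (hmul : ∀ a b c d : Fin 2, e a b * e c d = if b = c then e a d else 0) :
    (e 0 1 + e 1 0 + (1 - (e 0 0 + e 1 1))) * e 1 0 = e 0 0 := by
  rw [add_mul, add_mul, unit_mul_same hmul, unit_mul_ne hmul (by decide), one_sub_eps_mul_unit hmul, add_zero,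
    add_zero]

/-- `e₀₁ · T = e₀₀`. [folklore] -/
private theorem unit01_mul_flip (hmul : ∀ a b c d : Fin 2, e a b * e c d = if b = c then e a d else 0) :
    e 0 1 * (e 0 1 + e 1 0 + (1 - (e 0 0 + e 1 1))) = e 0 0 := by
  rw [mul_add, mul_add, unit_mul_ne hmul (by decide), unit_mul_same hmul, unit_mul_one_sub_eps hmul, zero_add,
    add_zero]

/-- A matrix commuting with the four units commutes with `T`. [folklore] -/
private theorem flip_comm {N : Matrix ι ι ℂ} (hN : ∀ a b, N * e a b = e a b * N) :
    N * (e 0 1 + e 1 0 + (1 - (e 0 0 + e 1 1))) = (e 0 1 + e 1 0 + (1 - (e 0 0 + e 1 1))) * N := by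
  simp only [mul_add, add_mul, mul_sub, sub_mul, mul_one, one_mul, hN]

/-- **Conjugation by `T` moves the `e₁₁`-corner embedding to the `e₀₀`-corner embedding**:
`T (N e₁₁ + 1 − e₁₁) T = N e₀₀ + 1 − e₀₀` for `N` commuting with the units. [folklore] -/
private theorem flip_conj_corner (hmul : ∀ a b c d : Fin 2, e a b * e c d = if b = c then e a d else 0)
    {N : Matrix ι ι ℂ} (hN : ∀ a b, N * e a b = e a b * N) :
    (e 0 1 + e 1 0 + (1 - (e 0 0 + e 1 1))) * (N * e 1 1 + (1 - e 1 1)) *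
        (e 0 1 + e 1 0 + (1 - (e 0 0 + e 1 1))) = N * e 0 0 + (1 - e 0 0) := by
  have hTT := flip_mul_flip hmul
  have hNT := flip_comm hN
  have hT11 := flip_mul_unit11 hmul
  have h01T := unit01_mul_flip hmul
  calc (e 0 1 + e 1 0 + (1 - (e 0 0 + e 1 1))) * (N * e 1 1 + (1 - e 1 1)) *
          (e 0 1 + e 1 0 + (1 - (e 0 0 + e 1 1)))
        = ((e 0 1 + e 1 0 + (1 - (e 0 0 + e 1 1))) * N) *
            (e 1 1 * (e 0 1 + e 1 0 + (1 - (e 0 0 + e 1 1)))) +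
          ((e 0 1 + e 1 0 + (1 - (e 0 0 + e 1 1))) * (e 0 1 + e 1 0 + (1 - (e 0 0 + e 1 1))) -
            ((e 0 1 + e 1 0 + (1 - (e 0 0 + e 1 1))) * e 1 1) * (e 0 1 + e 1 0 + (1 - (e 0 0 + e 1 1)))) := by
        noncomm_ring
    _ = N * e 0 0 + (1 - e 0 0) := by
        rw [← hNT, hTT, hT11, h01T, Matrix.mul_assoc,
          ← Matrix.mul_assoc (e 0 1 + e 1 0 + (1 - (e 0 0 + e 1 1))) (e 1 1), hT11, h01T]

/-- `det (T · Y · T) = det Y`. [folklore] -/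
private theorem det_flip_conj (hmul : ∀ a b c d : Fin 2, e a b * e c d = if b = c then e a d else 0)
    (Y : Matrix ι ι ℂ) :
    ((e 0 1 + e 1 0 + (1 - (e 0 0 + e 1 1))) * Y * (e 0 1 + e 1 0 + (1 - (e 0 0 + e 1 1)))).det = Y.det := by
  rw [det_mul, det_mul, mul_comm (det _) (det Y), mul_assoc, ← det_mul, flip_mul_flip hmul, det_one, mul_one]

/-- **The corner embedding is multiplicative**: `(N P + 1 − P)(N' P + 1 − P) = N N' P + 1 − P` for an idempotent
`P` and `N'` commuting with `P`. [folklore] -/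
private theorem corner_mul_corner {P N N' : Matrix ι ι ℂ} (hP : P * P = P) (hN' : N' * P = P * N') :
    (N * P + (1 - P)) * (N' * P + (1 - P)) = N * N' * P + (1 - P) := by
  have h1 : N * P * (N' * P) = N * N' * P := by
    rw [Matrix.mul_assoc, ← Matrix.mul_assoc P, ← hN', Matrix.mul_assoc N', hP, Matrix.mul_assoc]
  have h2 : N * P * (1 - P) = 0 := by rw [mul_sub, mul_one, Matrix.mul_assoc, hP, sub_self]
  have h3 : (1 - P) * (N' * P) = 0 := by
    rw [sub_mul, one_mul, ← Matrix.mul_assoc, ← hN', Matrix.mul_assoc, hP, sub_self]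
  have h4 : (1 - P) * (1 - P) = 1 - P := by
    rw [sub_mul, one_mul, mul_sub, mul_one, hP, sub_self, sub_zero]
  rw [add_mul, mul_add, mul_add, h1, h2, h3, h4, add_zero, zero_add]

end Units

/-! ## §2 The corner determinant `f(N) = det (N e₀₀ + 1 − e₀₀)` -/

section CornerDet

/-- **`f` is a polynomial function of the matrix entries**: `∃ F ∈ ℂ[x_{ij}], F(N) = det(N P + 1 − P)` for all
`N` (the determinant of `x · P + (1 − P)` for the generic matrix `x`). [folklore] -/
private theorem exists_evalMatC_eq_det_corner (P : Matrix ι ι ℂ) :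
    ∃ F : MvPolynomial (ι × ι) ℂ, ∀ N : Matrix ι ι ℂ, evalMatC N F = (N * P + (1 - P)).det := by
  refine ⟨(mvPolynomialX ι ι ℂ * P.map C + (1 - P.map C)).det, fun N ↦ ?_⟩
  have hC : (P.map (C : ℂ → MvPolynomial (ι × ι) ℂ)).map (evalMatC N) = P := by
    rw [Matrix.map_map]
    conv_rhs => rw [← Matrix.map_id P]
    congr 1
    funext c
    simp [evalMatC]
  rw [evalMatC, AlgHom.map_det, map_add, map_sub, map_mul, map_one, mvPolynomialX_mapMatrix_aeval,
    AlgHom.mapMatrix_apply, ← evalMatC, hC]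

variable {e : Fin 2 → Fin 2 → Matrix ι ι ℂ}

/-- `f(1) = 1`. [folklore] -/
private theorem det_corner_one (P : Matrix ι ι ℂ) : ((1 : Matrix ι ι ℂ) * P + (1 - P)).det = 1 := by
  rw [one_mul, add_sub_cancel, det_one]

/-- `f(N N') = f(N) f(N')` for `N'` commuting with the idempotent `P`. [folklore] -/
private theorem det_corner_mul {P N N' : Matrix ι ι ℂ} (hP : P * P = P) (hN' : N' * P = P * N') :
    (N * N' * P + (1 - P)).det = (N * P + (1 - P)).det * (N' * P + (1 - P)).det := by
  rw [← det_mul, corner_mul_corner hP hN']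

/-- `det (A†) = det A` for the adjoint involution `A† = Γ⁻¹ ᵗA Γ` of an invertible `Γ`. [folklore] -/
private theorem det_rosati {Γ : Matrix ι ι ℂ} (hΓ : IsUnit Γ.det) (A : Matrix ι ι ℂ) :
    (rosati Γ A).det = A.det := by
  rw [rosati_def, det_conj' ((isUnit_iff_isUnit_det Γ).2 hΓ), det_transpose]

/-- For `ᵗN Γ N = Γ`: `N† · N = 1`. [folklore] -/
private theorem rosati_mul_self_of_symplectic {Γ N : Matrix ι ι ℂ} (hΓ : IsUnit Γ.det) (hN : Nᵀ * Γ * N = Γ) :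
    rosati Γ N * N = 1 := by
  rw [rosati_def, Matrix.mul_assoc, Matrix.mul_assoc, ← Matrix.mul_assoc Nᵀ, hN, Matrix.nonsing_inv_mul _ hΓ]

/-- `det G_ℂ ≠ 0` for the complexified rational Gram matrix. [folklore] -/
private theorem isUnit_det_map_algebraMap {G : Matrix ι ι ℚ} (hGu : IsUnit G.det) :
    IsUnit (G.map (algebraMap ℚ ℂ)).det := by
  rw [show G.map (algebraMap ℚ ℂ) = (algebraMap ℚ ℂ).mapMatrix G from rfl, ← RingHom.map_det]
  exact hGu.map _

omit [Fintype ι] [DecidableEq ι] in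
/-- `ᵗ(G_ℂ) = −G_ℂ` for an alternating rational `G`. [folklore] -/
private theorem transpose_map_algebraMap {G : Matrix ι ι ℚ} (hGt : Gᵀ = -G) :
    (G.map (algebraMap ℚ ℂ))ᵀ = -G.map (algebraMap ℚ ℂ) := by
  rw [← transpose_map, hGt, Matrix.map_neg _ (map_neg (algebraMap ℚ ℂ))]

/-- **`f(N)² = 1` on `S(X)(ℂ)`** (`N` restricted to the corner `W = e₀₀V_ℂ` is orthogonal for the symmetric form
`E(x, e₁₀ y)`): with `†` the adjoint involution of `G_ℂ`, `det ∘ † = det`, `(N e₀₀ + 1 − e₀₀)† = e₁₁ N⁻¹ + 1 − e₁₁`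
(`e₀₀† = e₁₁`, `N† = N⁻¹`), `T (N⁻¹ e₁₁ + 1 − e₁₁) T = N⁻¹ e₀₀ + 1 − e₀₀`, so `f(N) = f(N⁻¹)`, and
`f(N) f(N⁻¹) = f(1) = 1`. [cite: Milne1999LefschetzClasses, §2 (p. 650–652: type III, `S(A)_{k^{al}} ≅ ∏ O(φ_{2,σ})`)] -/
theorem det_corner_mul_self_of_mem_lefschetzGroupC {E : Type*} [NormedAddCommGroup E] [NormedSpace ℂ E]
    (Φ : (ι → ℝ) ≃L[ℝ] E) {G : Matrix ι ι ℚ} (hGu : IsUnit G.det)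
    (hmul : ∀ a b c d : Fin 2, e a b * e c d = if b = c then e a d else 0)
    (hspan : ∀ a b,
      e a b ∈ Submodule.span ℂ ((fun A : Matrix ι ι ℚ ↦ A.map (algebraMap ℚ ℂ)) '' (endAlgRat Φ : Set (Matrix ι ι ℚ))))
    (h00 : rosati (G.map (algebraMap ℚ ℂ)) (e 0 0) = e 1 1)
    {N : SpecialLinearGroup ι ℂ} (hN : N ∈ lefschetzGroupC Φ G) :
    (N.1 * e 0 0 + (1 - e 0 0)).det * (N.1 * e 0 0 + (1 - e 0 0)).det = 1 := by
  have hΓu : IsUnit (G.map (algebraMap ℚ ℂ)).det := isUnit_det_map_algebraMap hGu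
  have hNc : ∀ a b, N.1 * e a b = e a b * N.1 := fun a b ↦
    mul_eq_mul_of_mem_lefschetzGroupC_of_mem_span Φ hN (hspan a b)
  have hN'c : ∀ a b, (N⁻¹).1 * e a b = e a b * (N⁻¹).1 := fun a b ↦
    mul_eq_mul_of_mem_lefschetzGroupC_of_mem_span Φ (inv_mem hN) (hspan a b)
  have hsymp : N.1ᵀ * G.map (algebraMap ℚ ℂ) * N.1 = G.map (algebraMap ℚ ℂ) :=
    ((mem_lefschetzGroupC_iff Φ).1 hN).1
  -- `N† = N⁻¹`
  have hinv' : N.1 * (N⁻¹).1 = 1 := by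
    rw [← SpecialLinearGroup.coe_mul, mul_inv_cancel, SpecialLinearGroup.coe_one]
  have hros : rosati (G.map (algebraMap ℚ ℂ)) N.1 = (N⁻¹).1 := by
    calc rosati (G.map (algebraMap ℚ ℂ)) N.1 = rosati (G.map (algebraMap ℚ ℂ)) N.1 * (N.1 * (N⁻¹).1) := by
          rw [hinv', mul_one]
      _ = (N⁻¹).1 := by rw [← Matrix.mul_assoc, rosati_mul_self_of_symplectic hΓu hsymp, one_mul]
  have h00sq : e 0 0 * e 0 0 = e 0 0 := unit_mul_same hmul 0 0 0
  -- `f(N) = f(N⁻¹)`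
  have hkey : (N.1 * e 0 0 + (1 - e 0 0)).det = ((N⁻¹).1 * e 0 0 + (1 - e 0 0)).det := by
    calc (N.1 * e 0 0 + (1 - e 0 0)).det
          = (rosati (G.map (algebraMap ℚ ℂ)) (N.1 * e 0 0 + (1 - e 0 0))).det := (det_rosati hΓu _).symm
      _ = ((N⁻¹).1 * e 1 1 + (1 - e 1 1)).det := by
          rw [rosati_add, rosati_sub, rosati_one hΓu, rosati_mul hΓu, h00, hros, hN'c]
      _ = ((N⁻¹).1 * e 0 0 + (1 - e 0 0)).det := by
          rw [← det_flip_conj hmul ((N⁻¹).1 * e 1 1 + (1 - e 1 1)), flip_conj_corner hmul hN'c]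
  -- `f(N) f(N⁻¹) = f(N N⁻¹) = f(1) = 1`
  have hprod : (N.1 * e 0 0 + (1 - e 0 0)).det * ((N⁻¹).1 * e 0 0 + (1 - e 0 0)).det = 1 := by
    rw [← det_corner_mul h00sq (hN'c 0 0), hinv', det_corner_one]
  rwa [← hkey] at hprod

/-- On `S(X)(ℂ)`: `f(N) = 1` or `f(N) = −1`. [cite: Milne1999LefschetzClasses, §2 (p. 652, table: type III, `O_{g/f}`)] -/
theorem det_corner_eq_one_or_eq_neg_one_of_mem_lefschetzGroupC {E : Type*} [NormedAddCommGroup E]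
    [NormedSpace ℂ E] (Φ : (ι → ℝ) ≃L[ℝ] E) {G : Matrix ι ι ℚ} (hGu : IsUnit G.det)
    (hmul : ∀ a b c d : Fin 2, e a b * e c d = if b = c then e a d else 0)
    (hspan : ∀ a b,
      e a b ∈ Submodule.span ℂ ((fun A : Matrix ι ι ℚ ↦ A.map (algebraMap ℚ ℂ)) '' (endAlgRat Φ : Set (Matrix ι ι ℚ))))
    (h00 : rosati (G.map (algebraMap ℚ ℂ)) (e 0 0) = e 1 1)
    {N : SpecialLinearGroup ι ℂ} (hN : N ∈ lefschetzGroupC Φ G) :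
    (N.1 * e 0 0 + (1 - e 0 0)).det = 1 ∨ (N.1 * e 0 0 + (1 - e 0 0)).det = -1 :=
  mul_self_eq_one_iff.1 (det_corner_mul_self_of_mem_lefschetzGroupC Φ hGu hmul hspan h00 hN)

end CornerDet

/-! ## §3 `f ≡ 1` on `Lf(X)(ℂ) = S(X)(ℂ)⁰`: the kernel of `f` is a closed subgroup of index `≤ 2` -/

section Kernel

variable {E : Type*} [NormedAddCommGroup E] [NormedSpace ℂ E] (Φ : (ι → ℝ) ≃L[ℝ] E) {G : Matrix ι ι ℚ}
  {e : Fin 2 → Fin 2 → Matrix ι ι ℂ}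

/-- **`f(N) = 1` for every `N ∈ Lf(X)(ℂ)`**: `K′ = {N ∈ S(X)(ℂ) | det(N e₀₀ + 1 − e₀₀) = 1}` is a Zariski-closed
subgroup of `S(X)(ℂ)` whose index is the (finite, `≤ 2`) cardinality of the image of `f : S(X)(ℂ) → {±1} ⊂ ℂˣ`;
by Springer 2.2.1 (iii) (`lefschetzIdentityC_le_of_relIndex_ne_zero`) it contains the identity component.
[cite: Springer1998, Prop. 2.2.1 (iii)] [cite: Milne1999LefschetzClasses, Remark 4.9 («fixed by the identity component of `S(A)` but not by `S(A)` itself»)] -/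
theorem det_corner_eq_one_of_mem_lefschetzIdentityC (hGu : IsUnit G.det)
    (hmul : ∀ a b c d : Fin 2, e a b * e c d = if b = c then e a d else 0)
    (hspan : ∀ a b,
      e a b ∈ Submodule.span ℂ ((fun A : Matrix ι ι ℚ ↦ A.map (algebraMap ℚ ℂ)) '' (endAlgRat Φ : Set (Matrix ι ι ℚ))))
    (h00 : rosati (G.map (algebraMap ℚ ℂ)) (e 0 0) = e 1 1)
    {N : SpecialLinearGroup ι ℂ} (hN : N ∈ lefschetzIdentityC Φ G) :
    (N.1 * e 0 0 + (1 - e 0 0)).det = 1 := by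
  have h00sq : e 0 0 * e 0 0 = e 0 0 := unit_mul_same hmul 0 0 0
  -- multiplicativity and `f² = 1` on `S(X)(ℂ)`
  have hfmul : ∀ M M' : SpecialLinearGroup ι ℂ, M' ∈ lefschetzGroupC Φ G →
      ((M * M').1 * e 0 0 + (1 - e 0 0)).det =
        (M.1 * e 0 0 + (1 - e 0 0)).det * (M'.1 * e 0 0 + (1 - e 0 0)).det := fun M M' hM' ↦ by
    rw [SpecialLinearGroup.coe_mul]
    exact det_corner_mul h00sq (mul_eq_mul_of_mem_lefschetzGroupC_of_mem_span Φ hM' (hspan 0 0))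
  have hfsq : ∀ M : SpecialLinearGroup ι ℂ, M ∈ lefschetzGroupC Φ G →
      (M.1 * e 0 0 + (1 - e 0 0)).det * (M.1 * e 0 0 + (1 - e 0 0)).det = 1 := fun M hM ↦
    det_corner_mul_self_of_mem_lefschetzGroupC Φ hGu hmul hspan h00 hM
  -- the subgroup `K′ = {f = 1} ∩ S(X)(ℂ)`
  let K' : Subgroup (SpecialLinearGroup ι ℂ) :=
    { carrier := {M | M ∈ lefschetzGroupC Φ G ∧ (M.1 * e 0 0 + (1 - e 0 0)).det = 1}
      mul_mem' := fun {M M'} hM hM' ↦ ⟨mul_mem hM.1 hM'.1, by rw [hfmul M M' hM'.1, hM.2, hM'.2, mul_one]⟩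
      one_mem' := ⟨one_mem _, by rw [SpecialLinearGroup.coe_one]; exact det_corner_one _⟩
      inv_mem' := fun {M} hM ↦ ⟨inv_mem hM.1, by
        have h := hfmul M M⁻¹ (inv_mem hM.1)
        rw [mul_inv_cancel, SpecialLinearGroup.coe_one, det_corner_one, hM.2, one_mul] at h
        exact h.symm⟩ }
  have hmemK' : ∀ M, M ∈ K' ↔ M ∈ lefschetzGroupC Φ G ∧ (M.1 * e 0 0 + (1 - e 0 0)).det = 1 := fun M ↦ Iff.rfl
  have hle : K' ≤ lefschetzGroupC Φ G := fun M hM ↦ ((hmemK' M).1 hM).1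
  -- Zariski-closed: the equations of `S(X)(ℂ)` and `F − 1`
  have hc : IsZariskiClosed K' := by
    obtain ⟨T, hT⟩ := (isZariskiClosed_lefschetzGroupC Φ G).exists_forall_mem_iff
    obtain ⟨F, hF⟩ := exists_evalMatC_eq_det_corner (e 0 0)
    refine ⟨⟨insert (F - 1) T, fun M ↦ ?_⟩⟩
    rw [hmemK', Set.forall_mem_insert, map_sub, map_one, hF, sub_eq_zero, ← hT]
    exact ⟨fun h ↦ ⟨h.2, h.1⟩, fun h ↦ ⟨h.2, h.1⟩⟩
  -- finite index: `K′ ∩ S = ker (f : S → ℂˣ)` and the image of `f` lies in `{1, −1}`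
  have hi : K'.relIndex (lefschetzGroupC Φ G) ≠ 0 := by
    let φ : lefschetzGroupC Φ G →* ℂˣ :=
      { toFun := fun M ↦ ⟨(M.1.1 * e 0 0 + (1 - e 0 0)).det, (M.1.1 * e 0 0 + (1 - e 0 0)).det, hfsq M.1 M.2,
          hfsq M.1 M.2⟩
        map_one' := Units.ext (by
          change ((1 : SpecialLinearGroup ι ℂ).1 * e 0 0 + (1 - e 0 0)).det = 1
          rw [SpecialLinearGroup.coe_one]; exact det_corner_one _)
        map_mul' := fun M M' ↦ Units.ext (by
          change ((M.1 * M'.1).1 * e 0 0 + (1 - e 0 0)).det =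
            (M.1.1 * e 0 0 + (1 - e 0 0)).det * (M'.1.1 * e 0 0 + (1 - e 0 0)).det
          exact hfmul M.1 M'.1 M'.2) }
    have hφ : ∀ M : lefschetzGroupC Φ G, (φ M : ℂ) = (M.1.1 * e 0 0 + (1 - e 0 0)).det := fun M ↦ rfl
    have hker : K'.subgroupOf (lefschetzGroupC Φ G) = φ.ker := by
      ext M
      rw [Subgroup.mem_subgroupOf, MonoidHom.mem_ker, Units.ext_iff, hφ, Units.val_one, hmemK']
      exact ⟨fun h ↦ h.2, fun h ↦ ⟨M.2, h⟩⟩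
    have hrange : ((φ.range : Subgroup ℂˣ) : Set ℂˣ) ⊆ {1, -1} := by
      rintro u ⟨M, rfl⟩
      rcases det_corner_eq_one_or_eq_neg_one_of_mem_lefschetzGroupC Φ hGu hmul hspan h00 M.2 with h | h
      · exact Or.inl (Units.ext (by rw [hφ, h, Units.val_one]))
      · exact Or.inr (Units.ext (by rw [hφ, h, Units.val_neg, Units.val_one]))
    have hfin : Finite (φ.range : Subgroup ℂˣ) :=
      ((Set.toFinite ({1, -1} : Set ℂˣ)).subset hrange).to_subtype
    rw [Subgroup.relIndex, hker, Subgroup.index_ker]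
    exact Nat.card_ne_zero.2 ⟨⟨1⟩, hfin⟩
  exact ((hmemK' N).1 (lefschetzIdentityC_le_of_relIndex_ne_zero Φ hle hc hi hN)).2

end Kernel

/-! ## §4 The quaternionic reflection `M₀` -/

section Reflection

variable {e : Fin 2 → Fin 2 → Matrix ι ι ℂ} {Γ : Matrix ι ι ℂ}

/-- `ᵗ(e₀₀) Γ = Γ e₁₁` and `ᵗ(e₁₀) Γ = −Γ e₁₀` from the involution hypotheses (`Γ A† = ᵗA Γ`). [folklore] -/
private theorem transpose_unit_mul (hΓ : IsUnit Γ.det) (h00 : rosati Γ (e 0 0) = e 1 1)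
    (h10 : rosati Γ (e 1 0) = -e 1 0) : (e 0 0)ᵀ * Γ = Γ * e 1 1 ∧ (e 1 0)ᵀ * Γ = -(Γ * e 1 0) := by
  constructor
  · rw [← h00, mul_rosati hΓ]
  · rw [← mul_neg, ← h10, mul_rosati hΓ]

/-- `Γ e₁₀` is a symmetric matrix (`ᵗΓ = −Γ`, `e₁₀† = −e₁₀`): the form `q(x, y) = ᵗx Γ e₁₀ y`. [folklore] -/
private theorem transpose_gram_mul_unit10 (hΓ : IsUnit Γ.det) (hΓt : Γᵀ = -Γ) (h10 : rosati Γ (e 1 0) = -e 1 0) :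
    (Γ * e 1 0)ᵀ = Γ * e 1 0 := by
  rw [transpose_mul, hΓt, mul_neg, ← mul_rosati hΓ, h10, mul_neg, neg_neg]

/-- **A corner vector on which the symmetric form `q` does not vanish**: there is `v = e₀₀ v` with
`ᵗv Γ e₁₀ v ≠ 0` (else, by polarisation, `ᵗe₀₀ Γ e₁₀ e₀₀ = 0`, i.e. `Γ e₁₁ e₁₀ = Γ e₁₀ = 0`, `e₁₀ = 0`,
`e₀₀ = e₀₁ e₁₀ = 0`). [folklore] -/
private theorem exists_corner_vector_form_ne_zero (hΓ : IsUnit Γ.det) (hΓt : Γᵀ = -Γ)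
    (hmul : ∀ a b c d : Fin 2, e a b * e c d = if b = c then e a d else 0)
    (h00 : rosati Γ (e 0 0) = e 1 1) (h10 : rosati Γ (e 1 0) = -e 1 0) (hne : e 0 0 ≠ 0) :
    ∃ v : ι → ℂ, e 0 0 *ᵥ v = v ∧ v ⬝ᵥ (Γ * e 1 0) *ᵥ v ≠ 0 := by
  by_contra h
  push Not at h
  have hSt : (Γ * e 1 0)ᵀ = Γ * e 1 0 := transpose_gram_mul_unit10 hΓ hΓt h10
  have h00sq : e 0 0 * e 0 0 = e 0 0 := unit_mul_same hmul 0 0 0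
  obtain ⟨ht00, -⟩ := transpose_unit_mul hΓ h00 h10
  -- `Q = ᵗe₀₀ (Γ e₁₀) e₀₀` is symmetric
  have hQt : ((e 0 0)ᵀ * (Γ * e 1 0) * e 0 0)ᵀ = (e 0 0)ᵀ * (Γ * e 1 0) * e 0 0 := by
    rw [transpose_mul, transpose_mul, transpose_transpose, hSt, ← Matrix.mul_assoc]
  -- the bilinear form of `Q` is `(x, y) ↦ q(e₀₀ x, e₀₀ y)`
  have hform : ∀ x y : ι → ℂ, (e 0 0 *ᵥ x) ⬝ᵥ (Γ * e 1 0) *ᵥ (e 0 0 *ᵥ y) =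
      x ⬝ᵥ ((e 0 0)ᵀ * (Γ * e 1 0) * e 0 0) *ᵥ y := fun x y ↦ by
    rw [dotProduct_mulVec, dotProduct_mulVec _ (e 0 0) y, vecMul_vecMul, ← vecMul_transpose, vecMul_vecMul,
      ← dotProduct_mulVec, ← Matrix.mul_assoc]
  -- the quadratic form of `Q` vanishes identically
  have hq : ∀ x : ι → ℂ, x ⬝ᵥ ((e 0 0)ᵀ * (Γ * e 1 0) * e 0 0) *ᵥ x = 0 := fun x ↦ by
    rw [← hform]
    exact h (e 0 0 *ᵥ x) (by rw [mulVec_mulVec, h00sq])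
  -- polarisation: the symmetric bilinear form of `Q` vanishes, so `Q = 0`
  have hsymm : ∀ x y : ι → ℂ, y ⬝ᵥ ((e 0 0)ᵀ * (Γ * e 1 0) * e 0 0) *ᵥ x =
      x ⬝ᵥ ((e 0 0)ᵀ * (Γ * e 1 0) * e 0 0) *ᵥ y := fun x y ↦ by
    rw [dotProduct_mulVec, dotProduct_comm, ← mulVec_transpose, hQt]
  have hb : ∀ x y : ι → ℂ, x ⬝ᵥ ((e 0 0)ᵀ * (Γ * e 1 0) * e 0 0) *ᵥ y = 0 := fun x y ↦ by
    have hxy := hq (x + y)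
    rw [mulVec_add, add_dotProduct, dotProduct_add, dotProduct_add, hq x, hq y, hsymm x y, zero_add, add_zero,
      ← two_mul, mul_eq_zero] at hxy
    exact hxy.resolve_left two_ne_zero
  have hQ0 : (e 0 0)ᵀ * (Γ * e 1 0) * e 0 0 = 0 := by
    ext i j
    simpa [mulVec_single_one, Matrix.col_apply] using hb (Pi.single i 1) (Pi.single j 1)
  -- unwind: `ᵗe₀₀ Γ e₁₀ e₀₀ = Γ e₁₁ e₁₀ e₀₀ = Γ e₁₀`
  have hQ' : (e 0 0)ᵀ * (Γ * e 1 0) * e 0 0 = Γ * e 1 0 := by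
    rw [← Matrix.mul_assoc, ht00, Matrix.mul_assoc, Matrix.mul_assoc, unit_mul_same hmul, unit_mul_same hmul]
  have h10z : e 1 0 = 0 := by
    have h1 : Γ⁻¹ * (Γ * e 1 0) = e 1 0 := by rw [← Matrix.mul_assoc, nonsing_inv_mul _ hΓ, one_mul]
    rw [← h1, ← hQ', hQ0, mul_zero]
  exact hne (by rw [← unit_mul_same hmul 0 1 0, h10z, mul_zero])

/-- The reflection `ρ = e₀₀ − c · v ᵗw` (`w = ᵗ(Γ e₁₀) v`) lies in the `e₀₀`-corner: `e₀₀ ρ = ρ = ρ e₀₀`.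
[folklore] -/
private theorem corner_reflection (hmul : ∀ a b c d : Fin 2, e a b * e c d = if b = c then e a d else 0)
    {v : ι → ℂ} (hv : e 0 0 *ᵥ v = v) {c : ℂ} {ρ : Matrix ι ι ℂ}
    (hρ : ρ = e 0 0 - c • vecMulVec v (v ᵥ* (Γ * e 1 0))) : e 0 0 * ρ = ρ ∧ ρ * e 0 0 = ρ := by
  constructor
  · rw [hρ, mul_sub, unit_mul_same hmul, mul_smul_comm, mul_vecMulVec, hv]
  · rw [hρ, sub_mul, unit_mul_same hmul, smul_mul_assoc, vecMulVec_mul, vecMul_vecMul, Matrix.mul_assoc,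
      unit_mul_same hmul]

/-- **`ρ² = e₀₀`** for `c · q = 2` (`q = ᵗv Γ e₁₀ v`): the reflection is an involution of the corner. [folklore] -/
private theorem reflection_mul_self (hmul : ∀ a b c d : Fin 2, e a b * e c d = if b = c then e a d else 0)
    {v : ι → ℂ} (hv : e 0 0 *ᵥ v = v) {c : ℂ} (hc : c * (v ⬝ᵥ (Γ * e 1 0) *ᵥ v) = 2) {ρ : Matrix ι ι ℂ}
    (hρ : ρ = e 0 0 - c • vecMulVec v (v ᵥ* (Γ * e 1 0))) : ρ * ρ = e 0 0 := by
  have hPe : c • vecMulVec v (v ᵥ* (Γ * e 1 0)) * e 0 0 = c • vecMulVec v (v ᵥ* (Γ * e 1 0)) := by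
    rw [smul_mul_assoc, vecMulVec_mul, vecMul_vecMul, Matrix.mul_assoc, unit_mul_same hmul]
  have heP : e 0 0 * (c • vecMulVec v (v ᵥ* (Γ * e 1 0))) = c • vecMulVec v (v ᵥ* (Γ * e 1 0)) := by
    rw [mul_smul_comm, mul_vecMulVec, hv]
  have hPP : c • vecMulVec v (v ᵥ* (Γ * e 1 0)) * (c • vecMulVec v (v ᵥ* (Γ * e 1 0))) =
      (2 : ℂ) • (c • vecMulVec v (v ᵥ* (Γ * e 1 0))) := by
    rw [smul_mul_assoc, mul_smul_comm, vecMulVec_mul_vecMulVec, ← dotProduct_mulVec, vecMulVec_smul, smul_smul,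
      smul_smul, smul_smul, mul_assoc, hc, mul_comm c 2]
  rw [hρ, sub_mul, mul_sub, mul_sub, unit_mul_same hmul, hPe, heP, hPP]
  module

/-- **`ρ† = e₁₀ ρ e₀₁`**: the adjoint of the corner reflection is its transport to the opposite corner
(`(v ᵗw)† = Γ⁻¹ w ᵗv Γ = (e₁₀ v) ᵗ(ᵗΓ v)` and `ᵗv Γ = ᵗw e₀₁`). [folklore] -/
private theorem rosati_reflection (hΓ : IsUnit Γ.det) (hΓt : Γᵀ = -Γ)
    (hmul : ∀ a b c d : Fin 2, e a b * e c d = if b = c then e a d else 0)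
    (h00 : rosati Γ (e 0 0) = e 1 1) (h10 : rosati Γ (e 1 0) = -e 1 0) {v : ι → ℂ} (hv : e 0 0 *ᵥ v = v)
    {c : ℂ} {ρ : Matrix ι ι ℂ} (hρ : ρ = e 0 0 - c • vecMulVec v (v ᵥ* (Γ * e 1 0))) :
    rosati Γ ρ = e 1 0 * ρ * e 0 1 := by
  obtain ⟨ht00, ht10⟩ := transpose_unit_mul hΓ h00 h10
  -- `Γ⁻¹ w = e₁₀ v`
  have h1 : Γ⁻¹ *ᵥ (v ᵥ* (Γ * e 1 0)) = e 1 0 *ᵥ v := by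
    rw [← mulVec_transpose, mulVec_mulVec, transpose_mul, hΓt, mul_neg, ht10, neg_neg, ← Matrix.mul_assoc,
      nonsing_inv_mul _ hΓ, one_mul]
  -- `ᵗv Γ = ᵗw e₀₁`
  have h2 : v ᵥ* Γ = v ᵥ* (Γ * e 1 0) ᵥ* e 0 1 := by
    rw [vecMul_vecMul, Matrix.mul_assoc, unit_mul_same hmul, ← ht00, ← vecMul_vecMul, vecMul_transpose, hv]
  have hL : rosati Γ ρ = e 1 1 - c • vecMulVec (e 1 0 *ᵥ v) (v ᵥ* (Γ * e 1 0) ᵥ* e 0 1) := by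
    rw [hρ, rosati_sub, rosati_smul, h00, rosati_def, transpose_vecMulVec, mul_vecMulVec, vecMulVec_mul, h1, h2]
  have hR : e 1 0 * ρ * e 0 1 = e 1 1 - c • vecMulVec (e 1 0 *ᵥ v) (v ᵥ* (Γ * e 1 0) ᵥ* e 0 1) := by
    rw [hρ, mul_sub, sub_mul, unit_mul_same hmul, unit_mul_same hmul, mul_smul_comm, smul_mul_assoc, mul_vecMulVec,
      vecMulVec_mul]
  rw [hL, hR]

/-- **`f(ρ) = det(ρ + 1 − e₀₀) = 1 − c·q = −1`** (the matrix determinant lemma). [folklore] -/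
private theorem det_reflection_corner {v : ι → ℂ} {c : ℂ} (hc : c * (v ⬝ᵥ (Γ * e 1 0) *ᵥ v) = 2)
    {ρ : Matrix ι ι ℂ} (hρ : ρ = e 0 0 - c • vecMulVec v (v ᵥ* (Γ * e 1 0))) :
    (ρ + (1 - e 0 0)).det = -1 := by
  have h1 : ρ + (1 - e 0 0) = 1 + vecMulVec (-(c • v)) (v ᵥ* (Γ * e 1 0)) := by
    rw [hρ, neg_vecMulVec, smul_vecMulVec]; abel
  rw [h1, vecMulVec_eq Unit, det_one_add_replicateCol_mul_replicateRow, dotProduct_neg, dotProduct_smul,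
    ← dotProduct_mulVec, smul_eq_mul, hc]
  norm_num

/-- **The mirror `M₀ = ρ + e₁₀ ρ e₀₁ + (1 − ε)` of a corner involution `ρ` (`e₀₀ ρ = ρ = ρ e₀₀`, `ρ² = e₀₀`) with
`ρ† = e₁₀ ρ e₀₁`: `M₀² = 1`, `M₀† = M₀`, `M₀` commutes with every unit, `M₀ (1 − ε) = 1 − ε = (1 − ε) M₀`,
`det M₀ = f(ρ)²`, and `M₀ e₀₀ + (1 − e₀₀) = ρ + (1 − e₀₀)`.** [folklore] -/
private theorem mirror_props (hΓ : IsUnit Γ.det) (hΓt : Γᵀ = -Γ)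
    (hmul : ∀ a b c d : Fin 2, e a b * e c d = if b = c then e a d else 0)
    (h00 : rosati Γ (e 0 0) = e 1 1) (h01 : rosati Γ (e 0 1) = -e 0 1) (h10 : rosati Γ (e 1 0) = -e 1 0)
    {ρ : Matrix ι ι ℂ} (heρ : e 0 0 * ρ = ρ) (hρe : ρ * e 0 0 = ρ) (hρρ : ρ * ρ = e 0 0)
    (hρt : rosati Γ ρ = e 1 0 * ρ * e 0 1) {M₀ : Matrix ι ι ℂ}
    (hM : M₀ = ρ + e 1 0 * ρ * e 0 1 + (1 - (e 0 0 + e 1 1))) :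
    M₀ * M₀ = 1 ∧ rosati Γ M₀ = M₀ ∧ (∀ a b, M₀ * e a b = e a b * M₀) ∧
      M₀ * (1 - (e 0 0 + e 1 1)) = 1 - (e 0 0 + e 1 1) ∧ (1 - (e 0 0 + e 1 1)) * M₀ = 1 - (e 0 0 + e 1 1) ∧
      M₀.det = (ρ + (1 - e 0 0)).det * (ρ + (1 - e 0 0)).det ∧ M₀ * e 0 0 + (1 - e 0 0) = ρ + (1 - e 0 0) := by
  have u := unit_mul_same hmul
  -- corner identities for `ρ`
  have hρ10 : ρ * e 1 0 = 0 := by rw [← hρe, Matrix.mul_assoc, unit_mul_ne hmul (by decide), mul_zero]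
  have hρ11 : ρ * e 1 1 = 0 := by rw [← hρe, Matrix.mul_assoc, unit_mul_ne hmul (by decide), mul_zero]
  have h01ρ : e 0 1 * ρ = 0 := by rw [← heρ, ← Matrix.mul_assoc, unit_mul_ne hmul (by decide), zero_mul]
  have h11ρ : e 1 1 * ρ = 0 := by rw [← heρ, ← Matrix.mul_assoc, unit_mul_ne hmul (by decide), zero_mul]
  have hρeps : ρ * (1 - (e 0 0 + e 1 1)) = 0 := by rw [mul_sub, mul_one, mul_add, hρe, hρ11, add_zero, sub_self]
  have hepsρ : (1 - (e 0 0 + e 1 1)) * ρ = 0 := by rw [sub_mul, one_mul, add_mul, heρ, h11ρ, add_zero, sub_self]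
  -- the opposite corner `σ = e₁₀ ρ e₀₁`
  have hσσ : e 1 0 * ρ * e 0 1 * (e 1 0 * ρ * e 0 1) = e 1 1 := by
    rw [show e 1 0 * ρ * e 0 1 * (e 1 0 * ρ * e 0 1) = e 1 0 * (ρ * (e 0 1 * e 1 0) * ρ) * e 0 1 by noncomm_ring,
      u, hρe, hρρ, u, u]
  have hρσ : ρ * (e 1 0 * ρ * e 0 1) = 0 := by rw [← Matrix.mul_assoc, ← Matrix.mul_assoc, hρ10, zero_mul, zero_mul]
  have hσρ : e 1 0 * ρ * e 0 1 * ρ = 0 := by rw [Matrix.mul_assoc, h01ρ, mul_zero]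
  have hσeps : e 1 0 * ρ * e 0 1 * (1 - (e 0 0 + e 1 1)) = 0 := by
    rw [Matrix.mul_assoc, unit_mul_one_sub_eps hmul, mul_zero]
  have hepsσ : (1 - (e 0 0 + e 1 1)) * (e 1 0 * ρ * e 0 1) = 0 := by
    rw [← Matrix.mul_assoc, ← Matrix.mul_assoc, one_sub_eps_mul_unit hmul, zero_mul, zero_mul]
  have hee := one_sub_eps_mul_self hmul
  -- `M₀² = 1`
  have hMM : M₀ * M₀ = 1 := by
    rw [hM]
    simp only [add_mul, mul_add, hρρ, hρσ, hσρ, hσσ, hρeps, hepsρ, hσeps, hepsσ, hee, add_zero, zero_add]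
    abel
  -- `M₀† = M₀`
  have hMt : rosati Γ M₀ = M₀ := by
    have h11 : rosati Γ (e 1 1) = e 0 0 := by rw [← h00, rosati_rosati hΓ hΓt]
    have hσt : rosati Γ (e 1 0 * ρ * e 0 1) = ρ := by
      rw [rosati_mul hΓ, rosati_mul hΓ, h01, h10, hρt,
        show -e 0 1 * (e 1 0 * ρ * e 0 1 * -e 1 0) = (e 0 1 * e 1 0) * ρ * (e 0 1 * e 1 0) by noncomm_ring,
        u, heρ, hρe]
    rw [hM, rosati_add, rosati_add, rosati_sub, rosati_one hΓ, rosati_add, hρt, hσt, h00, h11]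
    abel
  -- `M₀` commutes with the units
  have hσ00 : e 1 0 * ρ * e 0 1 * e 0 0 = 0 := by rw [Matrix.mul_assoc, unit_mul_ne hmul (by decide), mul_zero]
  have hσ01 : e 1 0 * ρ * e 0 1 * e 0 1 = 0 := by rw [Matrix.mul_assoc, unit_mul_ne hmul (by decide), mul_zero]
  have hσ10 : e 1 0 * ρ * e 0 1 * e 1 0 = e 1 0 * ρ := by rw [Matrix.mul_assoc, u, Matrix.mul_assoc, hρe]
  have hσ11 : e 1 0 * ρ * e 0 1 * e 1 1 = e 1 0 * ρ * e 0 1 := by rw [Matrix.mul_assoc (e 1 0 * ρ), u]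
  have h00σ : e 0 0 * (e 1 0 * ρ * e 0 1) = 0 := by
    rw [← Matrix.mul_assoc, ← Matrix.mul_assoc, unit_mul_ne hmul (by decide), zero_mul, zero_mul]
  have h01σ : e 0 1 * (e 1 0 * ρ * e 0 1) = ρ * e 0 1 := by rw [← Matrix.mul_assoc, ← Matrix.mul_assoc, u, heρ]
  have h10σ : e 1 0 * (e 1 0 * ρ * e 0 1) = 0 := by
    rw [← Matrix.mul_assoc, ← Matrix.mul_assoc, unit_mul_ne hmul (by decide), zero_mul, zero_mul]
  have h11σ : e 1 1 * (e 1 0 * ρ * e 0 1) = e 1 0 * ρ * e 0 1 := by rw [← Matrix.mul_assoc, ← Matrix.mul_assoc, u]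
  have hc00 : M₀ * e 0 0 = e 0 0 * M₀ := by
    rw [hM]; simp only [add_mul, mul_add, hρe, hσ00, one_sub_eps_mul_unit hmul, heρ, h00σ, unit_mul_one_sub_eps hmul]
  have hc01 : M₀ * e 0 1 = e 0 1 * M₀ := by
    rw [hM]
    simp only [add_mul, mul_add, hσ01, one_sub_eps_mul_unit hmul, h01ρ, h01σ, unit_mul_one_sub_eps hmul,
      add_zero, zero_add]
  have hc10 : M₀ * e 1 0 = e 1 0 * M₀ := by
    rw [hM]
    simp only [add_mul, mul_add, hρ10, hσ10, one_sub_eps_mul_unit hmul, h10σ, unit_mul_one_sub_eps hmul,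
      add_zero, zero_add]
  have hc11 : M₀ * e 1 1 = e 1 1 * M₀ := by
    rw [hM]
    simp only [add_mul, mul_add, hρ11, hσ11, one_sub_eps_mul_unit hmul, h11ρ, h11σ, unit_mul_one_sub_eps hmul,
      add_zero, zero_add]
  have hMe : ∀ a b, M₀ * e a b = e a b * M₀ := by
    intro a b
    obtain rfl | rfl := fin_two_eq_zero_or_eq_one a <;> obtain rfl | rfl := fin_two_eq_zero_or_eq_one b
    exacts [hc00, hc01, hc10, hc11]
  have hMeps : M₀ * (1 - (e 0 0 + e 1 1)) = 1 - (e 0 0 + e 1 1) := by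
    rw [hM, add_mul, add_mul, hρeps, hσeps, hee, zero_add, zero_add]
  have hepsM : (1 - (e 0 0 + e 1 1)) * M₀ = 1 - (e 0 0 + e 1 1) := by
    rw [hM, mul_add, mul_add, hepsρ, hepsσ, hee, zero_add, zero_add]
  -- `M₀ e₀₀ + (1 − e₀₀) = ρ + (1 − e₀₀)`
  have hM00 : M₀ * e 0 0 + (1 - e 0 0) = ρ + (1 - e 0 0) := by
    rw [hM, add_mul, add_mul, hρe, Matrix.mul_assoc (e 1 0 * ρ), unit_mul_ne hmul (by decide), mul_zero, add_zero,
      one_sub_eps_mul_unit hmul, add_zero]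
  -- `det M₀ = f(ρ)²`: `M₀ = (ρ + 1 − e₀₀)(σ + 1 − e₁₁)` and the second factor is `T`-conjugate to the first
  have hdet : M₀.det = (ρ + (1 - e 0 0)).det * (ρ + (1 - e 0 0)).det := by
    have hfac : (ρ + (1 - e 0 0)) * (e 1 0 * ρ * e 0 1 + (1 - e 1 1)) = M₀ := by
      rw [hM]
      simp only [add_mul, mul_add, mul_sub, sub_mul, mul_one, one_mul, hρσ, hρ11, h00σ,
        unit_mul_ne hmul (show (0 : Fin 2) ≠ 1 by decide)]
      abel
    have hTσ : (e 0 1 + e 1 0 + (1 - (e 0 0 + e 1 1))) * (e 1 0 * ρ * e 0 1) = e 0 0 * ρ * e 0 1 := by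
      rw [← Matrix.mul_assoc, ← Matrix.mul_assoc, flip_mul_unit10 hmul]
    have hσT : e 0 0 * ρ * e 0 1 * (e 0 1 + e 1 0 + (1 - (e 0 0 + e 1 1))) = ρ := by
      rw [Matrix.mul_assoc, unit01_mul_flip hmul, heρ, hρe]
    have hconj : (e 0 1 + e 1 0 + (1 - (e 0 0 + e 1 1))) * (e 1 0 * ρ * e 0 1 + (1 - e 1 1)) *
        (e 0 1 + e 1 0 + (1 - (e 0 0 + e 1 1))) = ρ + (1 - e 0 0) := by
      calc (e 0 1 + e 1 0 + (1 - (e 0 0 + e 1 1))) * (e 1 0 * ρ * e 0 1 + (1 - e 1 1)) *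
            (e 0 1 + e 1 0 + (1 - (e 0 0 + e 1 1)))
          = (e 0 1 + e 1 0 + (1 - (e 0 0 + e 1 1))) * (e 1 0 * ρ * e 0 1) *
              (e 0 1 + e 1 0 + (1 - (e 0 0 + e 1 1))) +
            ((e 0 1 + e 1 0 + (1 - (e 0 0 + e 1 1))) * (e 0 1 + e 1 0 + (1 - (e 0 0 + e 1 1))) -
              (e 0 1 + e 1 0 + (1 - (e 0 0 + e 1 1))) * e 1 1 * (e 0 1 + e 1 0 + (1 - (e 0 0 + e 1 1)))) := by
            noncomm_ring
        _ = ρ + (1 - e 0 0) := by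
            rw [hTσ, hσT, flip_mul_flip hmul, flip_mul_unit11 hmul, unit01_mul_flip hmul]
    have hdet2 : (e 1 0 * ρ * e 0 1 + (1 - e 1 1)).det = (ρ + (1 - e 0 0)).det := by
      rw [← hconj, det_flip_conj hmul]
    rw [← hfac, det_mul, hdet2]
  exact ⟨hMM, hMt, hMe, hMeps, hepsM, hdet, hM00⟩

end Reflection

/-! ## §5 `S(X)(ℂ)` is disconnected -/

section Main

variable {E : Type*} [NormedAddCommGroup E] [NormedSpace ℂ E] (Φ : (ι → ℝ) ≃L[ℝ] E) {G : Matrix ι ι ℚ}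
  {e : Fin 2 → Fin 2 → Matrix ι ι ℂ}

/-- **THE QUATERNIONIC REFLECTION AS AN ELEMENT OF `S(X)(ℂ)` WITH CORNER DETERMINANT `−1`.**  Under the
hypotheses of `exists_mem_lefschetzGroupC_not_mem_lefschetzIdentityC_of_matrixUnits` (a direct factor `M₂(ℂ)` of
`End_ℚ(X) ⊗ ℂ` spanned by matrix units `e a b` with symplectic adjoint involution) there is an INVOLUTION
`M₀ ∈ S(X)(ℂ)` (`M₀² = 1`) with `f(M₀) = det(M₀ e₀₀ + 1 − e₀₀) = −1`: `M₀` acts on the corner `W = e₀₀V_ℂ` as a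
reflection (the value of `f` is what Murty's exotic class `c`, the volume form of `W`, is multiplied by — «not fixed
by `S(A)` itself»). [cite: Milne1999LefschetzClasses, §2 (p. 650–652, simple abelian variety of type III: `S(A)_{k^{al}} ≅ ∏ O(φ_{2,σ})`) and Remark 4.9]
[cite: Gordon1999HodgeAVSurvey, §7.7, §8.6 (the determinant `Δ`)] -/
theorem exists_mem_lefschetzGroupC_det_corner_eq_neg_one_of_matrixUnits (hGu : IsUnit G.det)
    (hGt : Gᵀ = -G) (hmul : ∀ a b c d : Fin 2, e a b * e c d = if b = c then e a d else 0)
    (hcomm : ∀ A ∈ endAlgRat Φ, (e 0 0 + e 1 1) * A.map (algebraMap ℚ ℂ) = A.map (algebraMap ℚ ℂ) * (e 0 0 + e 1 1))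
    (habs : ∀ A ∈ endAlgRat Φ,
      (e 0 0 + e 1 1) * A.map (algebraMap ℚ ℂ) ∈ Submodule.span ℂ (Set.range fun p : Fin 2 × Fin 2 ↦ e p.1 p.2))
    (h00 : rosati (G.map (algebraMap ℚ ℂ)) (e 0 0) = e 1 1) (h01 : rosati (G.map (algebraMap ℚ ℂ)) (e 0 1) = -e 0 1)
    (h10 : rosati (G.map (algebraMap ℚ ℂ)) (e 1 0) = -e 1 0) (hne : e 0 0 ≠ 0) :
    ∃ M ∈ lefschetzGroupC Φ G, (M.1 * e 0 0 + (1 - e 0 0)).det = -1 ∧ M.1 * M.1 = 1 := by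
  have hΓu : IsUnit (G.map (algebraMap ℚ ℂ)).det := isUnit_det_map_algebraMap hGu
  have hΓt : (G.map (algebraMap ℚ ℂ))ᵀ = -G.map (algebraMap ℚ ℂ) := transpose_map_algebraMap hGt
  obtain ⟨v, hv, hq⟩ := exists_corner_vector_form_ne_zero hΓu hΓt hmul h00 h10 hne
  have hc : 2 / (v ⬝ᵥ (G.map (algebraMap ℚ ℂ) * e 1 0) *ᵥ v) * (v ⬝ᵥ (G.map (algebraMap ℚ ℂ) * e 1 0) *ᵥ v) = 2 :=
    div_mul_cancel₀ 2 hq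
  obtain ⟨ρ, hρ⟩ : ∃ ρ : Matrix ι ι ℂ,
      ρ = e 0 0 - (2 / (v ⬝ᵥ (G.map (algebraMap ℚ ℂ) * e 1 0) *ᵥ v)) •
        vecMulVec v (v ᵥ* (G.map (algebraMap ℚ ℂ) * e 1 0)) := ⟨_, rfl⟩
  obtain ⟨M₀, hM⟩ : ∃ M₀ : Matrix ι ι ℂ, M₀ = ρ + e 1 0 * ρ * e 0 1 + (1 - (e 0 0 + e 1 1)) := ⟨_, rfl⟩
  obtain ⟨heρ, hρe⟩ := corner_reflection hmul hv hρ
  have hf : (ρ + (1 - e 0 0)).det = -1 := det_reflection_corner hc hρ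
  obtain ⟨hMM, hMt, hMe, hMeps, hepsM, hdet, hM00⟩ := mirror_props hΓu hΓt hmul h00 h01 h10 heρ hρe
    (reflection_mul_self hmul hv hc hρ) (rosati_reflection hΓu hΓt hmul h00 h10 hv hρ) hM
  have hdet1 : M₀.det = 1 := by rw [hdet, hf]; norm_num
  refine ⟨⟨M₀, hdet1⟩, ?_, ?_, hMM⟩
  · -- `M₀ ∈ S(X)(ℂ)`: symplectic (`ᵗM₀ Γ M₀ = Γ M₀† M₀ = Γ M₀² = Γ`) and commuting with `End_ℚ(X)`
    refine (mem_lefschetzGroupC_iff Φ).2 ⟨?_, fun A hA ↦ ?_⟩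
    · change M₀ᵀ * G.map (algebraMap ℚ ℂ) * M₀ = G.map (algebraMap ℚ ℂ)
      rw [← mul_rosati hΓu, hMt, Matrix.mul_assoc, hMM, mul_one]
    · change M₀ * A.map (algebraMap ℚ ℂ) = A.map (algebraMap ℚ ℂ) * M₀
      -- `M₀` commutes with the span of the units
      have hsp : ∀ x ∈ Submodule.span ℂ (Set.range fun p : Fin 2 × Fin 2 ↦ e p.1 p.2), M₀ * x = x * M₀ := by
        intro x hx
        induction hx using Submodule.span_induction with
        | mem x hx => obtain ⟨p, rfl⟩ := hx; exact hMe p.1 p.2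
        | zero => rw [mul_zero, zero_mul]
        | add x y _ _ hx hy => rw [mul_add, add_mul, hx, hy]
        | smul c x _ hx => rw [mul_smul_comm, smul_mul_assoc, hx]
      have h1 : M₀ * ((e 0 0 + e 1 1) * A.map (algebraMap ℚ ℂ)) = (e 0 0 + e 1 1) * A.map (algebraMap ℚ ℂ) * M₀ :=
        hsp _ (habs A hA)
      have hεa : (1 - (e 0 0 + e 1 1)) * A.map (algebraMap ℚ ℂ) = A.map (algebraMap ℚ ℂ) * (1 - (e 0 0 + e 1 1)) := by
        rw [sub_mul, mul_sub, one_mul, mul_one, hcomm A hA]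
      have h2 : M₀ * ((1 - (e 0 0 + e 1 1)) * A.map (algebraMap ℚ ℂ)) =
          (1 - (e 0 0 + e 1 1)) * A.map (algebraMap ℚ ℂ) * M₀ := by
        calc M₀ * ((1 - (e 0 0 + e 1 1)) * A.map (algebraMap ℚ ℂ))
            = (1 - (e 0 0 + e 1 1)) * A.map (algebraMap ℚ ℂ) := by rw [← Matrix.mul_assoc, hMeps]
          _ = A.map (algebraMap ℚ ℂ) * ((1 - (e 0 0 + e 1 1)) * M₀) := by rw [hepsM, ← hεa]
          _ = (1 - (e 0 0 + e 1 1)) * A.map (algebraMap ℚ ℂ) * M₀ := by rw [← Matrix.mul_assoc, hεa]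
      calc M₀ * A.map (algebraMap ℚ ℂ)
          = M₀ * ((e 0 0 + e 1 1) * A.map (algebraMap ℚ ℂ)) + M₀ * ((1 - (e 0 0 + e 1 1)) * A.map (algebraMap ℚ ℂ)) := by
            rw [← mul_add, ← add_mul, add_sub_cancel, one_mul]
        _ = A.map (algebraMap ℚ ℂ) * M₀ := by rw [h1, h2, ← add_mul, ← add_mul, add_sub_cancel, one_mul]
  · -- `f(M₀) = det(ρ + 1 − e₀₀) = −1`
    change (M₀ * e 0 0 + (1 - e 0 0)).det = -1
    rw [hM00, hf]

/-- **THE QUATERNIONIC REFLECTION IS IN `S(X)(ℂ)` BUT NOT IN `Lf(X)(ℂ) = S(X)(ℂ)⁰`.**  For a complex torus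
`X = E/Φ(ℤ^ι)`, an invertible alternating rational matrix `G` (the Gram matrix of a polarisation) and a system of
`2 × 2` matrix units `e a b` in the `ℂ`-span of `End_ℚ(X)` forming a direct factor `M₂(ℂ)` of `End_ℚ(X) ⊗ ℂ`
(`ε = e₀₀ + e₁₁` central, `ε · End_ℚ(X) ⊆ span{e a b}`) on which the adjoint involution `A ↦ G_ℂ⁻¹ ᵗA G_ℂ` is the
symplectic one (`e₀₀† = e₁₁`, `e₀₁† = −e₀₁`, `e₁₀† = −e₁₀`) — Milne's type-III factor `O(φ_{2,σ})` of `S(A)_{k^{al}}`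
— there is `M₀ ∈ S(X)(ℂ)` with `M₀ ∉ S(X)(ℂ)⁰`: «III | `O_{g/f}` | connected: No».
[cite: Milne1999LefschetzClasses, §2 (p. 650–652, simple abelian variety of type III and Summary table) and Remark 4.9]
[cite: Gordon1999HodgeAVSurvey, §7.7 (type (III): «special orthogonal group»), §8.6] -/
theorem exists_mem_lefschetzGroupC_not_mem_lefschetzIdentityC_of_matrixUnits (hGu : IsUnit G.det)
    (hGt : Gᵀ = -G) (hmul : ∀ a b c d : Fin 2, e a b * e c d = if b = c then e a d else 0)
    (hspan : ∀ a b,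
      e a b ∈ Submodule.span ℂ ((fun A : Matrix ι ι ℚ ↦ A.map (algebraMap ℚ ℂ)) '' (endAlgRat Φ : Set (Matrix ι ι ℚ))))
    (hcomm : ∀ A ∈ endAlgRat Φ, (e 0 0 + e 1 1) * A.map (algebraMap ℚ ℂ) = A.map (algebraMap ℚ ℂ) * (e 0 0 + e 1 1))
    (habs : ∀ A ∈ endAlgRat Φ,
      (e 0 0 + e 1 1) * A.map (algebraMap ℚ ℂ) ∈ Submodule.span ℂ (Set.range fun p : Fin 2 × Fin 2 ↦ e p.1 p.2))
    (h00 : rosati (G.map (algebraMap ℚ ℂ)) (e 0 0) = e 1 1) (h01 : rosati (G.map (algebraMap ℚ ℂ)) (e 0 1) = -e 0 1)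
    (h10 : rosati (G.map (algebraMap ℚ ℂ)) (e 1 0) = -e 1 0) (hne : e 0 0 ≠ 0) :
    ∃ M ∈ lefschetzGroupC Φ G, M ∉ lefschetzIdentityC Φ G := by
  obtain ⟨M, hM, hf, -⟩ := exists_mem_lefschetzGroupC_det_corner_eq_neg_one_of_matrixUnits Φ hGu hGt hmul hcomm habs
    h00 h01 h10 hne
  refine ⟨M, hM, fun hL ↦ ?_⟩
  -- `M ∉ Lf(X)(ℂ)`: `f ≡ 1` there, but `f(M) = −1`
  have h1 := det_corner_eq_one_of_mem_lefschetzIdentityC Φ hGu hmul hspan h00 hL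
  rw [hf] at h1
  norm_num at h1

/-- **`Lf(X)(ℂ) = S(X)(ℂ)⁰ ⊊ S(X)(ℂ)`: the centraliser of `End_ℚ(X)` in `Sp(V, E)(ℂ)` is DISCONNECTED** as soon as
`End_ℚ(X) ⊗ ℂ` has a direct factor `M₂(ℂ)` with symplectic adjoint involution (hypotheses as in
`exists_mem_lefschetzGroupC_not_mem_lefschetzIdentityC_of_matrixUnits`) — Milne's table, type III: «connected: No».
[cite: Milne1999LefschetzClasses, §2 (p. 652, Summary table) and Remark 4.9] [cite: Gordon1999HodgeAVSurvey, §7.7, §8.6] -/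
theorem lefschetzIdentityC_lt_lefschetzGroupC_of_matrixUnits (hGu : IsUnit G.det) (hGt : Gᵀ = -G)
    (hmul : ∀ a b c d : Fin 2, e a b * e c d = if b = c then e a d else 0)
    (hspan : ∀ a b,
      e a b ∈ Submodule.span ℂ ((fun A : Matrix ι ι ℚ ↦ A.map (algebraMap ℚ ℂ)) '' (endAlgRat Φ : Set (Matrix ι ι ℚ))))
    (hcomm : ∀ A ∈ endAlgRat Φ, (e 0 0 + e 1 1) * A.map (algebraMap ℚ ℂ) = A.map (algebraMap ℚ ℂ) * (e 0 0 + e 1 1))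
    (habs : ∀ A ∈ endAlgRat Φ,
      (e 0 0 + e 1 1) * A.map (algebraMap ℚ ℂ) ∈ Submodule.span ℂ (Set.range fun p : Fin 2 × Fin 2 ↦ e p.1 p.2))
    (h00 : rosati (G.map (algebraMap ℚ ℂ)) (e 0 0) = e 1 1) (h01 : rosati (G.map (algebraMap ℚ ℂ)) (e 0 1) = -e 0 1)
    (h10 : rosati (G.map (algebraMap ℚ ℂ)) (e 1 0) = -e 1 0) (hne : e 0 0 ≠ 0) :
    lefschetzIdentityC Φ G < lefschetzGroupC Φ G := by
  obtain ⟨M, hM, hM'⟩ := exists_mem_lefschetzGroupC_not_mem_lefschetzIdentityC_of_matrixUnits Φ hGu hGt hmul hspan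
    hcomm habs h00 h01 h10 hne
  exact lt_of_le_of_ne (lefschetzIdentityC_le Φ G) fun h ↦ hM' (h ▸ hM)

/-- `Lf(X)(ℂ) ≠ S(X)(ℂ)` under the same hypotheses (the form consumed by A4-85's
`IsRiemannForm.exists_divisorClasses_lt_hodgeClasses_of_lefschetzIdentityC_ne_lefschetzGroupC`).
[cite: Milne1999LefschetzClasses, Remark 4.9] -/
theorem lefschetzIdentityC_ne_lefschetzGroupC_of_matrixUnits (hGu : IsUnit G.det) (hGt : Gᵀ = -G)
    (hmul : ∀ a b c d : Fin 2, e a b * e c d = if b = c then e a d else 0)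
    (hspan : ∀ a b,
      e a b ∈ Submodule.span ℂ ((fun A : Matrix ι ι ℚ ↦ A.map (algebraMap ℚ ℂ)) '' (endAlgRat Φ : Set (Matrix ι ι ℚ))))
    (hcomm : ∀ A ∈ endAlgRat Φ, (e 0 0 + e 1 1) * A.map (algebraMap ℚ ℂ) = A.map (algebraMap ℚ ℂ) * (e 0 0 + e 1 1))
    (habs : ∀ A ∈ endAlgRat Φ,
      (e 0 0 + e 1 1) * A.map (algebraMap ℚ ℂ) ∈ Submodule.span ℂ (Set.range fun p : Fin 2 × Fin 2 ↦ e p.1 p.2))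
    (h00 : rosati (G.map (algebraMap ℚ ℂ)) (e 0 0) = e 1 1) (h01 : rosati (G.map (algebraMap ℚ ℂ)) (e 0 1) = -e 0 1)
    (h10 : rosati (G.map (algebraMap ℚ ℂ)) (e 1 0) = -e 1 0) (hne : e 0 0 ≠ 0) :
    lefschetzIdentityC Φ G ≠ lefschetzGroupC Φ G :=
  (lefschetzIdentityC_lt_lefschetzGroupC_of_matrixUnits Φ hGu hGt hmul hspan hcomm habs h00 h01 h10 hne).ne

/-- **THE QUATERNIONIC REFLECTION IS THE IDENTITY OUTSIDE ITS FACTOR.**  The involution `M₀ ∈ S(X)(ℂ)` with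
`f(M₀) = det(M₀ e₀₀ + 1 − e₀₀) = −1` of `exists_mem_lefschetzGroupC_det_corner_eq_neg_one_of_matrixUnits` can be
chosen inside `ε M ε + (1 − ε)`, `ε = e₀₀ + e₁₁` the unit of the factor: `M₀ (1 − ε) = 1 − ε = (1 − ε) M₀`, and `M₀`
commutes with the units `e a b` — so on every OTHER type-III factor of `End_ℚ(X) ⊗ ℂ` (orthogonal to `ε`) it acts
trivially («`S(A)_{k^{al}} ≅ ∏_σ O(φ_{2,σ})`»: a reflection in ONE factor `σ`). (A4-91 item (b): the corner
determinant of the TOTAL corner `Σ_σ e^σ₀₀` takes the value `−1` on `M₀`.)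
[cite: Milne1999LefschetzClasses, §2 (p. 650–652: «`S(A)_{k^{al}} ≅ ∏ O(φ_{2,σ₁})`», Summary table) and Remark 4.9]
[cite: Gordon1999HodgeAVSurvey, §7.7, §8.6] -/
theorem exists_mem_lefschetzGroupC_det_corner_eq_neg_one_of_matrixUnits' (hGu : IsUnit G.det)
    (hGt : Gᵀ = -G) (hmul : ∀ a b c d : Fin 2, e a b * e c d = if b = c then e a d else 0)
    (hcomm : ∀ A ∈ endAlgRat Φ, (e 0 0 + e 1 1) * A.map (algebraMap ℚ ℂ) = A.map (algebraMap ℚ ℂ) * (e 0 0 + e 1 1))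
    (habs : ∀ A ∈ endAlgRat Φ,
      (e 0 0 + e 1 1) * A.map (algebraMap ℚ ℂ) ∈ Submodule.span ℂ (Set.range fun p : Fin 2 × Fin 2 ↦ e p.1 p.2))
    (h00 : rosati (G.map (algebraMap ℚ ℂ)) (e 0 0) = e 1 1) (h01 : rosati (G.map (algebraMap ℚ ℂ)) (e 0 1) = -e 0 1)
    (h10 : rosati (G.map (algebraMap ℚ ℂ)) (e 1 0) = -e 1 0) (hne : e 0 0 ≠ 0) :
    ∃ M ∈ lefschetzGroupC Φ G, (M.1 * e 0 0 + (1 - e 0 0)).det = -1 ∧ M.1 * M.1 = 1 ∧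
      M.1 * (1 - (e 0 0 + e 1 1)) = 1 - (e 0 0 + e 1 1) ∧ (1 - (e 0 0 + e 1 1)) * M.1 = 1 - (e 0 0 + e 1 1) ∧
      ∀ a b, M.1 * e a b = e a b * M.1 := by
  have hΓu : IsUnit (G.map (algebraMap ℚ ℂ)).det := isUnit_det_map_algebraMap hGu
  have hΓt : (G.map (algebraMap ℚ ℂ))ᵀ = -G.map (algebraMap ℚ ℂ) := transpose_map_algebraMap hGt
  obtain ⟨v, hv, hq⟩ := exists_corner_vector_form_ne_zero hΓu hΓt hmul h00 h10 hne
  have hc : 2 / (v ⬝ᵥ (G.map (algebraMap ℚ ℂ) * e 1 0) *ᵥ v) * (v ⬝ᵥ (G.map (algebraMap ℚ ℂ) * e 1 0) *ᵥ v) = 2 :=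
    div_mul_cancel₀ 2 hq
  obtain ⟨ρ, hρ⟩ : ∃ ρ : Matrix ι ι ℂ,
      ρ = e 0 0 - (2 / (v ⬝ᵥ (G.map (algebraMap ℚ ℂ) * e 1 0) *ᵥ v)) •
        vecMulVec v (v ᵥ* (G.map (algebraMap ℚ ℂ) * e 1 0)) := ⟨_, rfl⟩
  obtain ⟨M₀, hM⟩ : ∃ M₀ : Matrix ι ι ℂ, M₀ = ρ + e 1 0 * ρ * e 0 1 + (1 - (e 0 0 + e 1 1)) := ⟨_, rfl⟩
  obtain ⟨heρ, hρe⟩ := corner_reflection hmul hv hρ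
  have hf : (ρ + (1 - e 0 0)).det = -1 := det_reflection_corner hc hρ
  obtain ⟨hMM, hMt, hMe, hMeps, hepsM, hdet, hM00⟩ := mirror_props hΓu hΓt hmul h00 h01 h10 heρ hρe
    (reflection_mul_self hmul hv hc hρ) (rosati_reflection hΓu hΓt hmul h00 h10 hv hρ) hM
  have hdet1 : M₀.det = 1 := by rw [hdet, hf]; norm_num
  refine ⟨⟨M₀, hdet1⟩, ?_, ?_, hMM, hMeps, hepsM, hMe⟩
  · -- `M₀ ∈ S(X)(ℂ)`: symplectic (`ᵗM₀ Γ M₀ = Γ M₀† M₀ = Γ M₀² = Γ`) and commuting with `End_ℚ(X)`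
    refine (mem_lefschetzGroupC_iff Φ).2 ⟨?_, fun A hA ↦ ?_⟩
    · change M₀ᵀ * G.map (algebraMap ℚ ℂ) * M₀ = G.map (algebraMap ℚ ℂ)
      rw [← mul_rosati hΓu, hMt, Matrix.mul_assoc, hMM, mul_one]
    · change M₀ * A.map (algebraMap ℚ ℂ) = A.map (algebraMap ℚ ℂ) * M₀
      have hsp : ∀ x ∈ Submodule.span ℂ (Set.range fun p : Fin 2 × Fin 2 ↦ e p.1 p.2), M₀ * x = x * M₀ := by
        intro x hx
        induction hx using Submodule.span_induction with
        | mem x hx => obtain ⟨p, rfl⟩ := hx; exact hMe p.1 p.2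
        | zero => rw [mul_zero, zero_mul]
        | add x y _ _ hx hy => rw [mul_add, add_mul, hx, hy]
        | smul c x _ hx => rw [mul_smul_comm, smul_mul_assoc, hx]
      have h1 : M₀ * ((e 0 0 + e 1 1) * A.map (algebraMap ℚ ℂ)) = (e 0 0 + e 1 1) * A.map (algebraMap ℚ ℂ) * M₀ :=
        hsp _ (habs A hA)
      have hεa : (1 - (e 0 0 + e 1 1)) * A.map (algebraMap ℚ ℂ) = A.map (algebraMap ℚ ℂ) * (1 - (e 0 0 + e 1 1)) := by
        rw [sub_mul, mul_sub, one_mul, mul_one, hcomm A hA]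
      have h2 : M₀ * ((1 - (e 0 0 + e 1 1)) * A.map (algebraMap ℚ ℂ)) =
          (1 - (e 0 0 + e 1 1)) * A.map (algebraMap ℚ ℂ) * M₀ := by
        calc M₀ * ((1 - (e 0 0 + e 1 1)) * A.map (algebraMap ℚ ℂ))
            = (1 - (e 0 0 + e 1 1)) * A.map (algebraMap ℚ ℂ) := by rw [← Matrix.mul_assoc, hMeps]
          _ = A.map (algebraMap ℚ ℂ) * ((1 - (e 0 0 + e 1 1)) * M₀) := by rw [hepsM, ← hεa]
          _ = (1 - (e 0 0 + e 1 1)) * A.map (algebraMap ℚ ℂ) * M₀ := by rw [← Matrix.mul_assoc, hεa]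
      calc M₀ * A.map (algebraMap ℚ ℂ)
          = M₀ * ((e 0 0 + e 1 1) * A.map (algebraMap ℚ ℂ)) + M₀ * ((1 - (e 0 0 + e 1 1)) * A.map (algebraMap ℚ ℂ)) := by
            rw [← mul_add, ← add_mul, add_sub_cancel, one_mul]
        _ = A.map (algebraMap ℚ ℂ) * M₀ := by rw [h1, h2, ← add_mul, ← add_mul, add_sub_cancel, one_mul]
  · -- `f(M₀) = det(ρ + 1 − e₀₀) = −1`
    change (M₀ * e 0 0 + (1 - e 0 0)).det = -1
    rw [hM00, hf]

end Main

end ComplexTorus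

end Literature.Geometry.Kaehler

end
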